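import Mathlib
import Literature.MathematicalPhysics.QuantumFieldTheory.Balaban1983to89.B8Eq194CriterionDirichlet
import Literature.MathematicalPhysics.QuantumFieldTheory.Balaban1983to89.B8Eq194CriterionLattice

/-!
# [B8] (1.91) vs [4] (3.163): Q′ΔN(Q′) = 0 with FREE boundary — the cell's own lattice carriers
# (cell GAPS G-B8-19 (c), part 5: free chains/boxes, and the one-dimensional block system of `B9Thm311Lattice`)

statement-level skeleton of published theorems with citation tags; proofs where landed; nothing here is a claim
about the Yang–Mills mass gap

Seat p40 gen 8, Phase 2, B8 lane; fifth file of G-B8-19 (c) (part 1 `B8Eq194Criterion`: characterization `crit_iff`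
— read its CONTEXT / ERRATUM / HONEST SCOPE first; part 2 `…Torus`: product rule, periodic case; part 3 `…Dirichlet`:
[4] p. 394's Dirichlet case; part 4 `…Lattice`: dictionary with the (3.25)-lattice carriers of `B9Thm311Lattice`).
Kind: located reading note, constants only — NOT an error of either paper.

WHY.  Part 4 showed that on the cell's lattice carriers (flat background, scalar fibre) Δ = D†D of (3.23) is the
graph Laplacian of the bond set WITHOUT diagonal term (`lapL_flat_apply`): the carriers hold only the bonds inside
Ω₀, i.e. a FREE boundary — a third boundary condition besides the periodic one of part 2 and [4]'s Dirichlet one of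
part 3.  This file classifies it and closes the loop on the cell's own one-dimensional block system.

CONTENT.
§1 `inKer_iff_forall_site`, `inKer_congr`, **`crit_congr`** — N(Q′) and the criterion depend on the block map only
   through its partition (needed to pass between `cycBlk L : Fin N → ℕ` of parts 2–3 and a `Fin K`-valued block map,
   the unit lattice of the carriers being a finite type).
§2 FREE CHAINS {0, …, LK − 1} (weights `pathW N` of part 3, NO diagonal term) and free boxes (Kronecker sum):
   `not_crit_path_three` (L ≥ 3, K ≥ 2) and `not_crit_path_two` (L = 2, K ≥ 2) FAIL for EVERY diagonal term m
   (both test sites lie outside the block b′, so m never enters — this also re-derives part 3's Dirichlet failures);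
   **`crit_free_chain_iff` / `crit_free_box_iff`: Q′ΔN(Q′) = 0 ⟺ L = 1 ∨ K = 1** (one-site blocks, or ONE block
   per direction = the «no bond joins two blocks» case `crit_of_noCross`).
§3 THE CELL'S CARRIERS, d = 1: `chainBonds N` (bonds ⟨i, i+1⟩), `wOf_chainBonds` (their symmetrised unit weights =
   `pathW N`), `finBlk` (blocks of L sites as a map into Fin K), and **`H4_eq_Hp_iff_free_chain`**: for the free
   chain of N = LK sites with unit bond weights, flat background, scalar fibre, uniform block weights κ ≠ 0, ANY
   contours/centres and ANY (3.25)-data with a onto: **[4]'s H′ ((3.163)) = (1.91)'s H′ ⟺ L = 1 ∨ K = 1**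
   (part 4's `H4_eq_Hp_iff_crit` ∘ `wOf_chainBonds` ∘ `crit_congr` ∘ `crit_free_chain_iff`).  With part 4's
   `exists_data_flat` such data exist whenever the contours form an `IsBlockSystem`; gen 7's `Witness6` is the
   periodic cousin (L, K) = (3, 2).

SUMMARY OF THE THREE BOUNDARY CONDITIONS (scalar model, cubic blocks of side L, K per direction, every d ≥ 1):
periodic (part 2) ⟺ L = 1 ∨ K = 1 ∨ (L, K) = (2, 2); Dirichlet on ∂Ω₀ (part 3, [4] p. 394) ⟺ L = 1 ∨ (L, K) = (2, 1);
free (this file, the cell's carriers) ⟺ L = 1 ∨ K = 1.  In all three, every geometry with L ≥ 2 and K ≥ 2 other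
than the periodic 4-cycle violates the criterion, so (1.91)'s H′ ≠ [4]'s (3.163) there (G-B8-19 (b) stands).

HONEST SCOPE.  As in parts 1–4 (scalar model; flat background; block sums ≡ means); §3 is d = 1 only (the
d-dimensional carriers need the identification `wOf (box bonds) = piW (pathW)`, not made); no bound, no row head
changes.

Sources: [Balaban1985RegularSpaces] (1.91) p. 91 [PDF 17]; [Balaban1985BackgroundPropagators] (3.18)–(3.19) p. 393,
(3.21)–(3.25) p. 394, (3.162)–(3.165) p. 429 [PDF 5, 6, 41].
-/

namespace Literature.MathematicalPhysics.QuantumFieldTheory.Balaban1983to89.B8Eq194CriterionFree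

open Finset Literature.MathematicalPhysics.QuantumFieldTheory.Balaban1983to89.B8Eq194Criterion
  Literature.MathematicalPhysics.QuantumFieldTheory.Balaban1983to89.B8Eq194CriterionTorus
  Literature.MathematicalPhysics.QuantumFieldTheory.Balaban1983to89.B8Eq194CriterionDirichlet

/-! ## §1  Same partition, same criterion -/

section Congr

variable {S B B' : Type*} [Fintype S] [DecidableEq B] [DecidableEq B']

/-- N(Q′) only depends on the partition: it suffices to test the blocks of sites.
[cite: Balaban1985BackgroundPropagators, (3.21) p. 394] -/
theorem inKer_iff_forall_site (blk : S → B) (f : S → ℝ) :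
    InKer blk f ↔ ∀ x₀, ∑ x ∈ univ with blk x = blk x₀, f x = 0 := by
  refine ⟨fun h x₀ => h (blk x₀), fun h b => ?_⟩
  unfold blockSum
  by_cases hb : ∃ x₀, blk x₀ = b
  · obtain ⟨x₀, rfl⟩ := hb
    exact h x₀
  · refine Finset.sum_eq_zero fun x hx => ?_
    exact (hb ⟨x, (mem_filter.1 hx).2⟩).elim

/-- Two block maps with the same blocks have the same N(Q′). [cite: Balaban1985BackgroundPropagators, (3.21) p. 394] -/
theorem inKer_congr {blk : S → B} {blk' : S → B'} (h : ∀ x y, blk x = blk y ↔ blk' x = blk' y) (f : S → ℝ) :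
    InKer blk f ↔ InKer blk' f := by
  rw [inKer_iff_forall_site, inKer_iff_forall_site]
  have hfilt : ∀ x₀, (univ.filter fun x => blk x = blk x₀) = univ.filter fun x => blk' x = blk' x₀ :=
    fun x₀ => Finset.filter_congr fun x _ => h x x₀
  simp only [hfilt]

/-- … hence the same criterion. [cite: Balaban1985BackgroundPropagators, (3.163)–(3.165) p. 429] -/
theorem crit_congr {w : S → S → ℝ} {m : S → ℝ} {blk : S → B} {blk' : S → B'}
    (h : ∀ x y, blk x = blk y ↔ blk' x = blk' y) : Crit w m blk ↔ Crit w m blk' := by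
  unfold Crit
  simp only [inKer_congr h]

end Congr

/-! ## §2  Free chains and boxes (no diagonal term): the cell's own boundary condition -/

section Free

/-- helper: `pathW` is symmetric. [folklore] -/
private theorem pathW_symm' {N : ℕ} (x y : Fin N) : pathW N x y = pathW N y x := by
  simp only [pathW, or_comm]

/-- helper: `pathW` is non-negative. [folklore] -/
private theorem pathW_nonneg' {N : ℕ} (x y : Fin N) : 0 ≤ pathW N x y := by
  unfold pathW; split_ifs <;> norm_num

/-- L ≥ 3 and K ≥ 2 blocks: the criterion FAILS on the chain for EVERY diagonal term m (both test sites lie outside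
the block b′ = 1, so m does not enter). [cite: Balaban1985RegularSpaces, (1.91) p. 91;
Balaban1985BackgroundPropagators, (3.163)–(3.165) p. 429] -/
theorem not_crit_path_three {N L K : ℕ} (hN : N = L * K) (hL : 3 ≤ L) (hK : 2 ≤ K) (m : Fin N → ℝ) :
    ¬ Crit (pathW N) m (cycBlk (N := N) L) := by
  subst hN
  have hLK : 2 * L ≤ L * K := by nlinarith
  have hxN : L - 1 < L * K := by omega
  have h1N : 1 < L * K := by omega
  have hLN : L < L * K := by omega
  intro h
  have key := crit_iff.1 h 1 ⟨L - 1, hxN⟩ ⟨1, h1N⟩ (by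
    show (L - 1) / L = 1 / L
    rw [Nat.div_eq_of_lt (by omega), Nat.div_eq_of_lt (by omega)])
  have hA : ∑ y ∈ univ with cycBlk L y = 1, pathW (L * K) y ⟨1, h1N⟩ = 0 := by
    refine Finset.sum_eq_zero fun y hy => ?_
    have hy1 : y.val / L = 1 := (mem_filter.1 hy).2
    have hyL : L ≤ y.val := by
      by_contra hlt
      rw [Nat.div_eq_of_lt (by omega)] at hy1
      omega
    show (if ((1 : ℕ) = y.val + 1 ∨ y.val = 1 + 1) then (1 : ℝ) else 0) = 0
    rw [if_neg (by omega)]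
  have hB : (1 : ℝ) ≤ ∑ y ∈ univ with cycBlk L y = 1, pathW (L * K) y ⟨L - 1, hxN⟩ := by
    have hmem : (⟨L, hLN⟩ : Fin (L * K)) ∈ (univ.filter fun y : Fin (L * K) => cycBlk L y = 1) := by
      rw [mem_filter]
      exact ⟨mem_univ _, by show L / L = 1; exact Nat.div_self (by omega)⟩
    refine le_trans ?_ (Finset.single_le_sum (f := fun y => pathW (L * K) y ⟨L - 1, hxN⟩)
      (fun y _ => pathW_nonneg' y _) hmem)
    show (1 : ℝ) ≤ (if ((L - 1 : ℕ) = L + 1 ∨ (L : ℕ) = L - 1 + 1) then (1 : ℝ) else 0)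
    rw [if_pos (Or.inr (by omega))]
  rw [coef_of_ne (show ¬ (cycBlk L (⟨L - 1, hxN⟩ : Fin (L * K)) = 1) by
      show ¬ ((L - 1) / L = 1); rw [Nat.div_eq_of_lt (by omega)]; omega),
    coef_of_ne (show ¬ (cycBlk L (⟨1, h1N⟩ : Fin (L * K)) = 1) by
      show ¬ (1 / L = 1); rw [Nat.div_eq_of_lt (by omega)]; omega), hA, neg_zero] at key
  linarith

/-- L = 2 and K ≥ 2 blocks: the criterion FAILS on the chain for every diagonal term m.
[cite: Balaban1985RegularSpaces, (1.91) p. 91; Balaban1985BackgroundPropagators, (3.163)–(3.165) p. 429] -/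
theorem not_crit_path_two {N K : ℕ} (hN : N = 2 * K) (hK : 2 ≤ K) (m : Fin N → ℝ) :
    ¬ Crit (pathW N) m (cycBlk (N := N) 2) := by
  subst hN
  have h0 : 0 < 2 * K := by omega
  have h1 : 1 < 2 * K := by omega
  have h2 : 2 < 2 * K := by omega
  intro h
  have key := crit_iff.1 h 1 ⟨1, h1⟩ ⟨0, h0⟩ (by show 1 / 2 = 0 / 2; norm_num)
  have hA : ∑ y ∈ univ with cycBlk 2 y = 1, pathW (2 * K) y ⟨0, h0⟩ = 0 := by
    refine Finset.sum_eq_zero fun y hy => ?_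
    have hy1 : y.val / 2 = 1 := (mem_filter.1 hy).2
    show (if ((0 : ℕ) = y.val + 1 ∨ y.val = 0 + 1) then (1 : ℝ) else 0) = 0
    rw [if_neg (by omega)]
  have hB : (1 : ℝ) ≤ ∑ y ∈ univ with cycBlk 2 y = 1, pathW (2 * K) y ⟨1, h1⟩ := by
    have hmem : (⟨2, h2⟩ : Fin (2 * K)) ∈ (univ.filter fun y : Fin (2 * K) => cycBlk 2 y = 1) := by
      rw [mem_filter]
      exact ⟨mem_univ _, by show 2 / 2 = 1; norm_num⟩
    refine le_trans ?_ (Finset.single_le_sum (f := fun y => pathW (2 * K) y ⟨1, h1⟩)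
      (fun y _ => pathW_nonneg' y _) hmem)
    show (1 : ℝ) ≤ (if ((1 : ℕ) = 2 + 1 ∨ (2 : ℕ) = 1 + 1) then (1 : ℝ) else 0)
    rw [if_pos (Or.inr rfl)]
  rw [coef_of_ne (show ¬ (cycBlk 2 (⟨1, h1⟩ : Fin (2 * K)) = 1) by show ¬ (1 / 2 = 1); norm_num),
    coef_of_ne (show ¬ (cycBlk 2 (⟨0, h0⟩ : Fin (2 * K)) = 1) by show ¬ (0 / 2 = 1); norm_num),
    hA, neg_zero] at key
  linarith

/-- **Classification on the FREE chain** {0, …, LK − 1} (nearest-neighbour bonds inside the chain only, no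
diagonal term — the boundary condition the cell's lattice carriers `B9Thm311Lattice` realise), K blocks of L
consecutive sites: Q′ΔN(Q′) = 0 ⟺ L = 1 ∨ K = 1. [cite: Balaban1985RegularSpaces, (1.91) p. 91;
Balaban1985BackgroundPropagators, (3.23) p. 394, (3.163)–(3.165) p. 429] -/
theorem crit_free_chain_iff {N L K : ℕ} (hN : N = L * K) (hL : 1 ≤ L) (hK : 1 ≤ K) :
    Crit (pathW N) 0 (cycBlk (N := N) L) ↔ (L = 1 ∨ K = 1) := by
  constructor
  · intro h
    by_contra hne
    rcases Nat.lt_or_ge L 3 with hL3 | hL3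
    · obtain rfl : L = 2 := by omega
      exact not_crit_path_two hN (by omega) 0 h
    · exact not_crit_path_three hN hL3 (by omega) 0 h
  · rintro (hL1 | hK1)
    · subst hL1; exact crit_cyc_one _ _
    · subst hK1
      rw [Nat.mul_one] at hN
      subst hN
      exact crit_of_noCross pathW_symm' fun x y hne => (hne (by
        have := x.isLt; have := y.isLt
        show x.val / N = y.val / N
        rw [Nat.div_eq_of_lt (by omega), Nat.div_eq_of_lt (by omega)])).elim

/-- **Classification on the free box** {0, …, LK − 1}^ι (Kronecker-sum Laplacian, no diagonal term, cubic blocks):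
Q′ΔN(Q′) = 0 ⟺ L = 1 ∨ K = 1. [cite: Balaban1985RegularSpaces, (1.91) p. 91; Balaban1985BackgroundPropagators,
(3.23) p. 394, (3.163)–(3.165) p. 429] -/
theorem crit_free_box_iff {ι : Type*} [Fintype ι] [DecidableEq ι] [Nonempty ι] {N L K : ℕ} (hN : N = L * K)
    (hL : 1 ≤ L) (hK : 1 ≤ K) :
    Crit (piW fun _ : ι => pathW N) 0 (piBlk fun _ : ι => cycBlk (N := N) L) ↔ (L = 1 ∨ K = 1) := by
  haveI : Nonempty (Fin N) := ⟨⟨0, by rw [hN]; exact Nat.mul_pos hL hK⟩⟩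
  have hm : (0 : (ι → Fin N) → ℝ) = piM (fun _ : ι => (0 : Fin N → ℝ)) := by
    funext x; simp [piM]
  rw [hm, crit_pi_iff]
  exact (forall_const ι).trans (crit_free_chain_iff hN hL hK)

end Free

/-! ## §3  On the cell's one-dimensional block-system carriers -/

section Lattice

open Literature.MathematicalPhysics.QuantumFieldTheory.Balaban1983to89.B8Eq194CriterionLattice
  B9Eq325Proj B9Thm311Lattice B8Eq191Hprime B8Eq194FirstTerm
open scoped InnerProductSpace

/-- The bonds ⟨i, i + 1⟩ of the chain {0, …, N − 1}. [cite: Balaban1985BackgroundPropagators, (3.23) p. 394] -/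
def chainBonds (N : ℕ) : Finset (Fin N × Fin N) := univ.filter fun b => b.2.val = b.1.val + 1

/-- The symmetrised unit weights of the chain bonds are the path weights `pathW`.
[cite: Balaban1985BackgroundPropagators, (3.23) p. 394] -/
theorem wOf_chainBonds (N : ℕ) : wOf (chainBonds N) (fun _ => (1 : ℝ)) = pathW N := by
  funext x z
  unfold wOf chainBonds pathW
  simp only [mem_filter, mem_univ, true_and]
  by_cases h1 : z.val = x.val + 1
  · by_cases h2 : x.val = z.val + 1
    · exfalso; omega
    · rw [if_pos h1, if_neg h2, if_pos (Or.inl h1), add_zero]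
  · by_cases h2 : x.val = z.val + 1
    · rw [if_neg h1, if_pos h2, if_pos (Or.inr h2), zero_add]
    · rw [if_neg h1, if_neg h2, if_neg (by omega), add_zero]

/-- Blocks of L consecutive sites as a block map into the unit-lattice points Fin K.
[cite: Balaban1985BackgroundPropagators, (3.18)–(3.19) p. 393] -/
def finBlk (L K : ℕ) {N : ℕ} (hN : N = L * K) (x : Fin N) : Fin K :=
  ⟨x.val / L, by
    have hx : x.val < K * L := by rw [Nat.mul_comm, ← hN]; exact x.isLt
    rcases Nat.eq_zero_or_pos L with hL | hL
    · rw [hL, Nat.mul_zero] at hx; exact absurd hx (Nat.not_lt_zero _)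
    · exact (Nat.div_lt_iff_lt_mul hL).2 hx⟩

/-- `finBlk` and `cycBlk` define the same partition. [folklore] -/
private theorem finBlk_iff (L K : ℕ) {N : ℕ} (hN : N = L * K) (x y : Fin N) :
    finBlk L K hN x = finBlk L K hN y ↔ cycBlk L x = cycBlk L y := by
  rw [Fin.ext_iff]; rfl

/-- **On the cell's one-dimensional block-system carriers** — the free chain of N = LK sites with unit bond weights,
flat background, scalar fibre, K blocks of L sites with uniform weights κ ≠ 0, any contours Γ / centres y, any
(3.25)-data with the positive weight operator a —: [4]'s H′ ((3.163)) = (1.91)'s H′ ⟺ L = 1 ∨ K = 1.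
[cite: Balaban1985RegularSpaces, (1.91) p. 91; Balaban1985BackgroundPropagators, (3.19) p. 393, (3.23)–(3.25)
p. 394, (3.163)–(3.165) p. 429] -/
theorem H4_eq_Hp_iff_free_chain {N L K : ℕ} (hN : N = L * K) (hL : 1 ≤ L) (hK : 1 ≤ K) {κ : ℝ} (hκ : κ ≠ 0)
    (Γ : Fin K → Fin N → List (Fin N)) (y : Fin K → Fin N)
    {A : PiLp 2 (fun _ : Fin K => ℝ) →ₗ[ℝ] PiLp 2 (fun _ : Fin K => ℝ)}
    {g : PiLp 2 (fun _ : Fin N => ℝ) →ₗ[ℝ] PiLp 2 (fun _ : Fin N => ℝ)}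
    {c : PiLp 2 (fun _ : Fin K => ℝ) →ₗ[ℝ] PiLp 2 (fun _ : Fin K => ℝ)}
    (hdata : Data (lapL (flatT (Fin N)) (chainBonds N) (fun _ => 1))
      (qL (flatT (Fin N)) (fun _ _ => κ) (blocksOf (finBlk L K hN)) Γ y)
      (LinearMap.adjoint (qL (flatT (Fin N)) (fun _ _ => κ) (blocksOf (finBlk L K hN)) Γ y)) A g c)
    (hA : Function.Surjective A) :
    (∀ μ, H4 (qL (flatT (Fin N)) (fun _ _ => κ) (blocksOf (finBlk L K hN)) Γ y)
        (LinearMap.adjoint (qL (flatT (Fin N)) (fun _ _ => κ) (blocksOf (finBlk L K hN)) Γ y)) A g c μ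
        = Hp (LinearMap.adjoint (qL (flatT (Fin N)) (fun _ _ => κ) (blocksOf (finBlk L K hN)) Γ y)) g c μ)
      ↔ (L = 1 ∨ K = 1) := by
  rw [H4_eq_Hp_iff_crit (finBlk L K hN) hκ Γ y (chainBonds N) (fun _ => 1) (fun _ _ => zero_le_one) hdata hA,
    wOf_chainBonds, crit_congr (finBlk_iff L K hN)]
  exact crit_free_chain_iff hN hL hK

end Lattice

end Literature.MathematicalPhysics.QuantumFieldTheory.Balaban1983to89.B8Eq194CriterionFree
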